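import Literature.NumberTheory.EllipticCurves.GaussianLatticeKroneckerLimit
import Literature.NumberTheory.EllipticCurves.WeierstrassZetaLegendre
import Literature.NumberTheory.EllipticCurves.NeronSigmaFunction
import Literature.NumberTheory.LFunctions.GaussianThetaLValueOne
import HarnessLib

/-!
# Gauss-damped Eisenstein summation of weight one on an arbitrary complex lattice:
# Kronecker's limit formula `lim ∑ e^{-y|z-l|²}/(z-l) = ζ(z) - η(z)` from two convergent points

Topic `Literature/NumberTheory/EllipticCurves` (complex-lattice cluster: `WeierstrassZeta`,
`WeierstrassZetaLegendre`, `NeronSigmaFunction`, `GaussianLatticeKroneckerLimit`). For a period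
lattice `Λ = ℤω₁ + ℤω₂` (`L : PeriodPair`) and `z ∈ ℂ` put

  `K_y(z) = ∑_{l ∈ Λ} e^{-y |z - l|²} / (z - l)`   (`PeriodPair.kroneckerSum`, `y > 0`),

the Gauss-damped (disc-centred) summation of the conditionally convergent Eisenstein series of
weight one — the summation by which the Dirichlet series `∑_{β ≡ α (𝔪)} β̄ |β|^{-2s}` of an
imaginary quadratic field reaches `s = 1` (`Literature.NumberTheory.LFunctions.BinaryThetaLValueOne`),
i.e. Rubin's `E₁(z; L)` (LNM 1716, Def. 7.11) at division points. `GaussianLatticeKroneckerLimit`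
proved, for the square lattice `ℤi + ℤ` only and using its rotation by `i`,
`K_y(z) → ζ(z) - π z̄`. Here we prove the general statement, **Rubin's Prop. 7.12 (`k = 1`)**:

* `PeriodPair.tendsto_kroneckerSum_of_tendsto₂` — if `y ∑_l e^{-y|l|²}` stays bounded as
  `y → 0⁺` and `K_y(z₁)`, `K_y(z₂)` converge for two `ℝ`-independent points `z₁, z₂`, then for
  **every** `z ∈ ℂ`

    `lim_{y → 0⁺} K_y(z) = ζ(z; Λ) - η(z; Λ)`,

  where `ζ` is the Weierstrass zeta function (`PeriodPair.weierstrassZeta`) and `η : ℂ → ℂ` the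
  `ℝ`-linear extension of the quasi-period map `ω ↦ ζ(z + ω) - ζ(z)` (`PeriodPair.quasiPeriodMap`,
  Silverman *Advanced Topics* VI.3.1) — Rubin's `η(z; L) = s₂(L) z + A(L)⁻¹ z̄` (Def. 7.9), so
  that the limit is his `E₁(z; L) = (log σ)'(z) - s₂(L) z - A(L)⁻¹ z̄` (Prop. 7.12).

The two hypotheses are discharged elsewhere for the lattices of complex multiplication
(`ℤ ⊕ ℤ√-N` and its parity sublattices: the bound from Jacobi's theta inversion, the convergence
at division points from the theta continuation `BinaryThetaSeries`/`BinaryThetaLValueOne`).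

## Proof

Write `e^{-y|z-l|²} = e^{-y|z|²} e^{-y|l|²} e^{u_l}`, `u_l = 2y Re(z l̄)`, and
`1/(z-l) = g(l) - h(l)` with `g(l) = 1/(z-l) + 1/l + z/l²` (the zeta summand) and
`h(l) = 1/l + z/l²`. As in the Gaussian file, `∑ e^{-y|z-l|²} g(l) → ζ(z)` (Tannery) and, expanding
`e^u = 1 + u + ρ(u)`, the `ρ`-part of `∑ e^{-y|z-l|²} h(l)` is `O(√y)` (this uses only
`|l| ≥ r(Λ) > 0` off `0` and the bound on `y ∑ e^{-y|l|²}`). The sums of the *odd* functions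
`e^{-y|l|²}/l`, `e^{-y|l|²} l̄/l²` vanish on any lattice (`l ↦ -l`), so what is left is
**`ℝ`-linear in `z`**:

  `K_y(z) = G_y(z) - e^{-y|z|²} (α(y) z + β(y) z̄ + Rem_y(z))`,
  `α(y) = ∑' e^{-y|l|²}/l² + y ∑' e^{-y|l|²} l̄/l`,  `β(y) = y (∑ e^{-y|l|²} - 1)`

(`PeriodPair.kroneckerSum_eq`). No asymptotics of `α`, `β` are computed. Instead: convergence of
`K_y` at two `ℝ`-independent points gives convergence of `α(y) z_j + β(y) z̄_j` (`j = 1, 2`), hence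
(a `2 × 2` real-linear system) of `α(y) → α₀` and `β(y) → β₀`, hence convergence of `K_y(z)` to
`ζ(z) - (α₀ z + β₀ z̄)` at **every** `z`. Finally `K_y(z + ω) = K_y(z)` for `ω ∈ Λ` (reindex),
while `ζ(z + ωᵢ) = ζ(z) + ηᵢ` (`PeriodPair.weierstrassZeta_add_ωᵢ_eq`); comparing the limits at
`ω₁/2` and `ω₁/2 + ωᵢ` gives `α₀ ωᵢ + β₀ ω̄ᵢ = ηᵢ`, so the `ℝ`-linear map `z ↦ α₀ z + β₀ z̄` is
`L.quasiPeriodMap` (they agree on the real basis `(ω₁, ω₂)`). As a by-product `β₀ = A(L)⁻¹` and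
`α₀ = s₂(L)` receive their meaning from the Legendre relation, without any theta-function
asymptotics in weight two.

## References

* K. Rubin, *Elliptic curves with complex multiplication and the conjecture of Birch and
  Swinnerton-Dyer*, LNM 1716 (1999), §7.4: Def. 7.9, Def. 7.11, Prop. 7.12 (held:
  `book:coates1999-arithmetic-theory-elliptic-curves`, p. 244). [Rubin1999]
* A. Weil, *Elliptic Functions according to Eisenstein and Kronecker*, Springer 1976, Ch. VI §2,
  Ch. VIII (Eisenstein summation, `E₁*`, Kronecker's limit formulas).
* J. H. Silverman, *Advanced Topics in the Arithmetic of Elliptic Curves*, GTM 151, Prop. VI.3.1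
  (the `ℝ`-linear quasi-period map). [Silverman1994]
-/

noncomputable section

open Complex Real Filter Topology Asymptotics PeriodPair
open Literature.NumberTheory.EllipticCurves.GaussianLattice
open scoped ComplexConjugate

namespace PeriodPair

variable (L : PeriodPair)

/-! ### The objects -/

/-- **The Gauss-damped Eisenstein sum of weight one** `K_y(z) = ∑_{l ∈ Λ} e^{-y|z-l|²}/(z - l)`
(for `z ∈ Λ` the term `l = z` is the junk value `e⁰/0 = 0`). Rubin's `E₁(z; L)` is its limit as
`y → 0⁺` (LNM 1716 Def. 7.11, summed at `s = 1` by Gaussian damping; deliberate dot-notation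
extension of Mathlib's `PeriodPair`). [cite: Rubin1999, §7.4 Def. 7.11] -/
def kroneckerSum (y : ℝ) (z : ℂ) : ℂ :=
  ∑' l : L.lattice, (rexp (-y * ‖z - (l : ℂ)‖ ^ 2) : ℂ) / (z - l)

/-- The lattice Gaussian sum `N(y) = ∑_{l ∈ Λ} e^{-y|l|²}` (a real number). [folklore] -/
def gaussN (y : ℝ) : ℝ := ∑' l : L.lattice, rexp (-y * ‖(l : ℂ)‖ ^ 2)

/-- The damped weight-two sum `A(y) = ∑_{l ≠ 0} e^{-y|l|²}/l²` (the term `l = 0` is `0`).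
[folklore] -/
def gaussA (y : ℝ) : ℂ := ∑' l : L.lattice, (rexp (-y * ‖(l : ℂ)‖ ^ 2) : ℂ) / (l : ℂ) ^ 2

/-- The damped angular sum `B(y) = ∑_{l ≠ 0} e^{-y|l|²} l̄/l` (the term `l = 0` is `0`).
[folklore] -/
def gaussB (y : ℝ) : ℂ := ∑' l : L.lattice, (rexp (-y * ‖(l : ℂ)‖ ^ 2) : ℂ) * (conj (l : ℂ) / l)

/-- The coefficient of `z` in the first-order part: `α(y) = A(y) + y B(y)`. [folklore] -/
def kroneckerCoefα (y : ℝ) : ℂ := L.gaussA y + y * L.gaussB y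

/-- The coefficient of `z̄` in the first-order part: `β(y) = y (N(y) - 1)`. [folklore] -/
def kroneckerCoefβ (y : ℝ) : ℂ := y * ((L.gaussN y : ℂ) - 1)

/-- The remainder sum `Rem_y(z) = ∑_l e^{-y|l|²} (e^{u_l} - 1 - u_l) (1/l + z/l²)`,
`u_l = 2y Re(z l̄)`. [folklore] -/
def gaussRem (y : ℝ) (z : ℂ) : ℂ :=
  ∑' l : L.lattice, (rexp (-y * ‖(l : ℂ)‖ ^ 2) : ℂ) *
    ((rexp (2 * y * (z * conj (l : ℂ)).re) - 1 - 2 * y * (z * conj (l : ℂ)).re : ℝ) : ℂ) *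
    (1 / (l : ℂ) + z / (l : ℂ) ^ 2)

/-! ### The lattice: a positive lower bound for nonzero points; Gaussian sums converge -/

/-- **Nonzero lattice points are bounded away from `0`**: there is `0 < r ≤ 1` with `r ≤ |l|`
for all `l ∈ Λ ∖ {0}` (`Λ` is discrete: the closed unit ball of `Λ` is finite). [folklore] -/
theorem exists_pos_forall_le_norm :
    ∃ r : ℝ, 0 < r ∧ r ≤ 1 ∧ ∀ l : L.lattice, (l : ℂ) ≠ 0 → r ≤ ‖(l : ℂ)‖ := by
  classical
  have hfin : (Metric.closedBall (0 : L.lattice) 1).Finite :=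
    isCompact_iff_finite.mp (isCompact_closedBall _ _)
  set S : Finset ℝ := insert 1 ((hfin.toFinset.filter fun l : L.lattice ↦ (l : ℂ) ≠ 0).image
    fun l : L.lattice ↦ ‖(l : ℂ)‖) with hS
  have hSne : S.Nonempty := ⟨1, Finset.mem_insert_self _ _⟩
  have hpos : ∀ x ∈ S, 0 < x := by
    intro x hx
    rw [hS, Finset.mem_insert] at hx
    rcases hx with rfl | hx
    · exact one_pos
    · obtain ⟨l, hl, rfl⟩ := Finset.mem_image.mp hx
      rw [Finset.mem_filter] at hl
      exact norm_pos_iff.mpr hl.2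
  refine ⟨S.min' hSne, hpos _ (Finset.min'_mem S hSne),
    Finset.min'_le S 1 (Finset.mem_insert_self _ _), fun l hl ↦ ?_⟩
  rcases le_or_gt ‖(l : ℂ)‖ 1 with h1 | h1
  · apply Finset.min'_le
    rw [hS, Finset.mem_insert]
    right
    refine Finset.mem_image.mpr ⟨l, ?_, rfl⟩
    rw [Finset.mem_filter, Set.Finite.mem_toFinset, Metric.mem_closedBall, dist_zero_right]
    exact ⟨h1, hl⟩
  · exact (Finset.min'_le S 1 (Finset.mem_insert_self _ _)).trans h1.le

/-- **`∑_{l ∈ Λ} e^{-y|l|²}` converges** for `y > 0` (`e^{-u} ≤ 2/u²` and `∑_{l ≠ 0} |l|⁻⁴ < ∞`).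
[folklore] -/
theorem summable_exp_neg_mul_norm_sq {y : ℝ} (hy : 0 < y) :
    Summable fun l : L.lattice ↦ rexp (-y * ‖(l : ℂ)‖ ^ 2) := by
  have hsum : Summable fun l : L.lattice ↦ 2 / y ^ 2 * ‖l‖ ^ (-4 : ℝ) :=
    (ZLattice.summable_norm_rpow _ _ (by simp; norm_num)).mul_left _
  refine Summable.of_norm_bounded_eventually hsum ?_
  have hfin : ({0} : Set L.lattice).Finite := Set.finite_singleton 0
  refine Filter.mem_of_superset hfin.compl_mem_cofinite fun l hl ↦ ?_
  have hl0 : (l : ℂ) ≠ 0 := by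
    intro h
    apply hl
    rw [Set.mem_singleton_iff]
    exact Submodule.coe_eq_zero.mp h
  have hn : 0 < ‖(l : ℂ)‖ := norm_pos_iff.mpr hl0
  rw [Set.mem_setOf_eq, Real.norm_eq_abs, abs_of_pos (Real.exp_pos _)]
  have h := Literature.NumberTheory.LFunctions.GaussianTheta.exp_neg_le_two_div_sq
    (mul_pos hy (pow_pos hn 2))
  rw [show -(y * ‖(l : ℂ)‖ ^ 2) = -y * ‖(l : ℂ)‖ ^ 2 by ring] at h
  refine h.trans (le_of_eq ?_)
  rw [show (‖l‖ : ℝ) = ‖(l : ℂ)‖ from rfl, Real.rpow_neg hn.le,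
    show (4 : ℝ) = ((4 : ℕ) : ℝ) by norm_num, Real.rpow_natCast]
  field_simp

/-- A family `e^{-y|l|²} F(l)` with `F` bounded is summable over `Λ` (`y > 0`). [folklore] -/
theorem summable_exp_mul_of_norm_le' {y : ℝ} (hy : 0 < y) {F : L.lattice → ℂ} {C : ℝ}
    (hF : ∀ l, ‖F l‖ ≤ C) :
    Summable fun l : L.lattice ↦ (rexp (-y * ‖(l : ℂ)‖ ^ 2) : ℂ) * F l := by
  refine Summable.of_norm_bounded ((L.summable_exp_neg_mul_norm_sq hy).mul_right C) fun l ↦ ?_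
  rw [norm_mul, Complex.norm_real, Real.norm_eq_abs, abs_of_pos (Real.exp_pos _)]
  exact mul_le_mul_of_nonneg_left (hF l) (Real.exp_pos _).le

/-- **Gauss-weighted sums of odd functions over `Λ` vanish** (reindex by `l ↦ -l`; no
summability needed). [folklore] -/
theorem tsum_exp_mul_eq_zero_of_odd (y : ℝ) {F : ℂ → ℂ} (hF : ∀ w, F (-w) = -F w) :
    ∑' l : L.lattice, (rexp (-y * ‖(l : ℂ)‖ ^ 2) : ℂ) * F l = 0 := by
  set S : ℂ := ∑' l : L.lattice, (rexp (-y * ‖(l : ℂ)‖ ^ 2) : ℂ) * F l with hS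
  have h : S = -S := by
    conv_lhs => rw [hS, ← (Equiv.neg L.lattice).tsum_eq]
    rw [hS, ← tsum_neg]
    congr 1
    funext l
    simp only [Equiv.neg_apply, Submodule.coe_neg, norm_neg, hF]
    ring
  have h2 : (2 : ℂ) * S = 0 := by linear_combination h
  simpa using h2

/-! ### Bounds for `h(l) = 1/l + z/l²` off zero -/

/-- `‖1/l + z/l²‖ ≤ 1/r + ‖z‖/r²` on `Λ` when `r ≤ |l|` for all nonzero `l`. [folklore] -/
theorem norm_h_le' {r : ℝ} (hr : 0 < r) (hrl : ∀ l : L.lattice, (l : ℂ) ≠ 0 → r ≤ ‖(l : ℂ)‖)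
    (z : ℂ) (l : L.lattice) : ‖1 / (l : ℂ) + z / (l : ℂ) ^ 2‖ ≤ 1 / r + ‖z‖ / r ^ 2 := by
  rcases eq_or_ne (l : ℂ) 0 with hl | hl
  · rw [hl, div_zero, zero_pow two_ne_zero, div_zero, add_zero, norm_zero]
    positivity
  · have h1 := hrl l hl
    refine (norm_add_le _ _).trans (add_le_add ?_ ?_)
    · rw [norm_div, norm_one]
      exact one_div_le_one_div_of_le hr h1
    · rw [norm_div, norm_pow]
      exact div_le_div_of_nonneg_left (norm_nonneg z) (by positivity)
        (pow_le_pow_left₀ hr.le h1 2)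

/-- `‖1/l + z/l²‖ ≤ (1 + ‖z‖/r)/‖l‖` for `l ≠ 0` in `Λ`. [folklore] -/
theorem norm_h_le_div' {r : ℝ} (hr : 0 < r) (hrl : ∀ l : L.lattice, (l : ℂ) ≠ 0 → r ≤ ‖(l : ℂ)‖)
    (z : ℂ) {l : L.lattice} (hl : (l : ℂ) ≠ 0) :
    ‖1 / (l : ℂ) + z / (l : ℂ) ^ 2‖ ≤ (1 + ‖z‖ / r) / ‖(l : ℂ)‖ := by
  have h1 := hrl l hl
  have hl0 : 0 < ‖(l : ℂ)‖ := by linarith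
  calc ‖1 / (l : ℂ) + z / (l : ℂ) ^ 2‖ ≤ ‖1 / (l : ℂ)‖ + ‖z / (l : ℂ) ^ 2‖ := norm_add_le _ _
    _ = 1 / ‖(l : ℂ)‖ + ‖z‖ / ‖(l : ℂ)‖ ^ 2 := by rw [norm_div, norm_one, norm_div, norm_pow]
    _ ≤ 1 / ‖(l : ℂ)‖ + ‖z‖ / (r * ‖(l : ℂ)‖) :=
        add_le_add le_rfl (div_le_div_of_nonneg_left (norm_nonneg z) (mul_pos hr hl0)
          (show r * ‖(l : ℂ)‖ ≤ ‖(l : ℂ)‖ ^ 2 by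
            rw [sq]; exact mul_le_mul_of_nonneg_right h1 hl0.le))
    _ = (1 + ‖z‖ / r) / ‖(l : ℂ)‖ := by field_simp

/-! ### The zeta part: dominated convergence -/

/-- **The Weierstrass zeta series of `Λ` converges absolutely**: `∑ ‖1/(z-l) + 1/l + z/l²‖ < ∞`
(terms `O(|l|⁻³)`, `PeriodPair.weierstrassZeta_bound`). [folklore] -/
theorem summable_norm_zetaSummand' (z : ℂ) :
    Summable fun l : L.lattice ↦ ‖1 / (z - l) + 1 / (l : ℂ) + z / (l : ℂ) ^ 2‖ := by
  set r : ℝ := ‖z‖ + 1 with hr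
  have hr0 : 0 < r := by positivity
  have hzr : ‖z‖ < r := by rw [hr]; linarith
  have hsum : Summable fun l : L.lattice ↦ 2 * r ^ 2 * ‖l‖ ^ (-3 : ℝ) :=
    (ZLattice.summable_norm_rpow _ _ (by simp; norm_num)).mul_left _
  refine Summable.of_norm_bounded_eventually hsum ?_
  have hfin : (Metric.closedBall (0 : L.lattice) (2 * r)).Finite :=
    isCompact_iff_finite.mp (isCompact_closedBall _ _)
  refine Filter.mem_of_superset hfin.compl_mem_cofinite fun l hl ↦ ?_
  rw [Set.mem_setOf_eq, Real.norm_eq_abs, abs_of_nonneg (norm_nonneg _)]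
  have h2 : 2 * r ≤ ‖(l : ℂ)‖ := by
    simp only [Set.mem_compl_iff, Metric.mem_closedBall, dist_zero_right, not_le] at hl
    exact hl.le
  exact PeriodPair.weierstrassZeta_bound r hr0 z hzr l h2

/-- **`∑_l e^{-y|z-l|²} (1/(z-l) + 1/l + z/l²) → ζ(z)`** as `y → 0⁺` (Tannery's theorem).
[folklore] -/
theorem tendsto_tsum_exp_mul_zetaSummand' (z : ℂ) :
    Tendsto (fun y : ℝ ↦ ∑' l : L.lattice,
      (rexp (-y * ‖z - (l : ℂ)‖ ^ 2) : ℂ) * (1 / (z - l) + 1 / (l : ℂ) + z / (l : ℂ) ^ 2))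
      (𝓝[>] 0) (𝓝 (L.weierstrassZeta z)) := by
  unfold PeriodPair.weierstrassZeta
  refine tendsto_tsum_of_dominated_convergence (L.summable_norm_zetaSummand' z)
    (fun l ↦ ?_) ?_
  · have h := (tendsto_ofReal_exp_neg_mul (‖z - (l : ℂ)‖ ^ 2)).mul_const
      (1 / (z - l) + 1 / (l : ℂ) + z / (l : ℂ) ^ 2)
    rwa [one_mul] at h
  · filter_upwards [self_mem_nhdsWithin] with y (hy : 0 < y)
    intro l
    rw [norm_mul, Complex.norm_real, Real.norm_eq_abs, abs_of_pos (Real.exp_pos _)]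
    refine mul_le_of_le_one_left (norm_nonneg _) ?_
    rw [Real.exp_le_one_iff]
    nlinarith [sq_nonneg ‖z - (l : ℂ)‖]

/-! ### The first-order part is `ℝ`-linear in `z` -/

/-- Zeroth order: `∑ e^{-y|l|²} (1/l + z/l²) = z A(y)` (the sum of `e^{-y|l|²}/l` vanishes).
[folklore] -/
theorem tsum_exp_mul_h' (z : ℂ) {y : ℝ} (hy : 0 < y) :
    ∑' l : L.lattice, (rexp (-y * ‖(l : ℂ)‖ ^ 2) : ℂ) * (1 / (l : ℂ) + z / (l : ℂ) ^ 2) =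
      z * L.gaussA y := by
  obtain ⟨r, hr, -, hrl⟩ := L.exists_pos_forall_le_norm
  have hs1 : Summable fun l : L.lattice ↦ (rexp (-y * ‖(l : ℂ)‖ ^ 2) : ℂ) * (1 / (l : ℂ)) :=
    L.summable_exp_mul_of_norm_le' hy (C := 1 / r) fun l ↦ by
      rcases eq_or_ne (l : ℂ) 0 with hl | hl
      · rw [hl]; simp; positivity
      · rw [norm_div, norm_one]; exact one_div_le_one_div_of_le hr (hrl l hl)
  have hs2 : Summable fun l : L.lattice ↦ (rexp (-y * ‖(l : ℂ)‖ ^ 2) : ℂ) * (z / (l : ℂ) ^ 2) :=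
    L.summable_exp_mul_of_norm_le' hy (C := ‖z‖ / r ^ 2) fun l ↦ by
      rcases eq_or_ne (l : ℂ) 0 with hl | hl
      · rw [hl]; simp; positivity
      · rw [norm_div, norm_pow]
        exact div_le_div_of_nonneg_left (norm_nonneg z) (by positivity)
          (pow_le_pow_left₀ hr.le (hrl l hl) 2)
  simp_rw [mul_add]
  rw [hs1.tsum_add hs2]
  have e1 : ∑' l : L.lattice, (rexp (-y * ‖(l : ℂ)‖ ^ 2) : ℂ) * (1 / (l : ℂ)) = 0 :=
    L.tsum_exp_mul_eq_zero_of_odd y (F := fun w ↦ 1 / w) fun w ↦ by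
      rw [one_div, one_div, inv_neg]
  have e2 : ∑' l : L.lattice, (rexp (-y * ‖(l : ℂ)‖ ^ 2) : ℂ) * (z / (l : ℂ) ^ 2) =
      z * L.gaussA y := by
    unfold gaussA
    rw [← tsum_mul_left]
    refine tsum_congr fun l ↦ ?_
    ring
  rw [e1, e2, zero_add]

/-- The indicator sum `∑ e^{-y|l|²} (l/l) = N(y) - 1` (the term `l = 0` is missing). [folklore] -/
theorem tsum_exp_mul_div_self' {y : ℝ} (hy : 0 < y) :
    ∑' l : L.lattice, (rexp (-y * ‖(l : ℂ)‖ ^ 2) : ℂ) * ((l : ℂ) / l) = (L.gaussN y : ℂ) - 1 := by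
  have hs := L.summable_exp_neg_mul_norm_sq hy
  have hsC : Summable fun l : L.lattice ↦ ((rexp (-y * ‖(l : ℂ)‖ ^ 2) : ℝ) : ℂ) :=
    (Complex.hasSum_ofReal.mpr hs.hasSum).summable
  have hsI : Summable fun l : L.lattice ↦ (if l = 0 then (1 : ℂ) else 0) :=
    summable_of_ne_finset_zero (s := {0}) (by
      intro l hl; rw [Finset.mem_singleton] at hl; exact if_neg hl)
  have key : ∀ l : L.lattice, (rexp (-y * ‖(l : ℂ)‖ ^ 2) : ℂ) * ((l : ℂ) / l) =
      (rexp (-y * ‖(l : ℂ)‖ ^ 2) : ℂ) - (if l = 0 then (1 : ℂ) else 0) := by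
    intro l
    by_cases hl : l = 0
    · subst hl; simp
    · have hl' : (l : ℂ) ≠ 0 := by rwa [Ne, Submodule.coe_eq_zero]
      rw [if_neg hl, div_self hl', mul_one, sub_zero]
  simp_rw [key]
  rw [hsC.tsum_sub hsI, tsum_ite_eq, gaussN, Complex.ofReal_tsum]

/-- **First order**: `∑ e^{-y|l|²} · 2y Re(z l̄) · (1/l + z/l²) = y z B(y) + y z̄ (N(y) - 1)`
(the sums of the odd functions `e^{-y|l|²} l̄/l²`, `e^{-y|l|²}/l` vanish). [folklore] -/
theorem tsum_exp_mul_u_mul_h' (z : ℂ) {y : ℝ} (hy : 0 < y) :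
    ∑' l : L.lattice, (rexp (-y * ‖(l : ℂ)‖ ^ 2) : ℂ) * ((2 * y * (z * conj (l : ℂ)).re : ℝ) : ℂ) *
        (1 / (l : ℂ) + z / (l : ℂ) ^ 2) =
      y * z * L.gaussB y + y * conj z * ((L.gaussN y : ℂ) - 1) := by
  obtain ⟨r, hr, -, hrl⟩ := L.exists_pos_forall_le_norm
  -- pointwise algebra
  have key : ∀ l : L.lattice,
      (rexp (-y * ‖(l : ℂ)‖ ^ 2) : ℂ) * ((2 * y * (z * conj (l : ℂ)).re : ℝ) : ℂ) *
        (1 / (l : ℂ) + z / (l : ℂ) ^ 2) =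
      (y * z) * ((rexp (-y * ‖(l : ℂ)‖ ^ 2) : ℂ) * (conj (l : ℂ) / l)) +
      (y * z ^ 2) * ((rexp (-y * ‖(l : ℂ)‖ ^ 2) : ℂ) * (conj (l : ℂ) / (l : ℂ) ^ 2)) +
      (y * conj z) * ((rexp (-y * ‖(l : ℂ)‖ ^ 2) : ℂ) * ((l : ℂ) / l)) +
      (y * (z * conj z)) * ((rexp (-y * ‖(l : ℂ)‖ ^ 2) : ℂ) * (1 / (l : ℂ))) := by
    intro l
    rw [ofReal_two_mul_re]
    rcases eq_or_ne (l : ℂ) 0 with hl | hl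
    · rw [hl]; simp
    · field_simp
      ring
  simp_rw [key]
  -- summability of the four families
  have hb : ∀ l : L.lattice, ‖conj (l : ℂ) / l‖ ≤ 1 := by
    intro l
    rcases eq_or_ne (l : ℂ) 0 with hl | hl
    · rw [hl]; simp
    · rw [norm_div, Complex.norm_conj, div_self (norm_ne_zero_iff.mpr hl)]
  have hb2 : ∀ l : L.lattice, ‖conj (l : ℂ) / (l : ℂ) ^ 2‖ ≤ 1 / r := by
    intro l
    rcases eq_or_ne (l : ℂ) 0 with hl | hl
    · rw [hl]; simp; positivity
    · have h1l := hrl l hl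
      have hn0 : 0 < ‖(l : ℂ)‖ := by linarith
      rw [norm_div, Complex.norm_conj, norm_pow, sq, ← div_div, div_self hn0.ne']
      exact one_div_le_one_div_of_le hr h1l
  have hb3 : ∀ l : L.lattice, ‖(l : ℂ) / l‖ ≤ 1 := by
    intro l
    rcases eq_or_ne (l : ℂ) 0 with hl | hl
    · rw [hl]; simp
    · rw [div_self hl, norm_one]
  have hb4 : ∀ l : L.lattice, ‖1 / (l : ℂ)‖ ≤ 1 / r := by
    intro l
    rcases eq_or_ne (l : ℂ) 0 with hl | hl
    · rw [hl]; simp; positivity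
    · rw [norm_div, norm_one]
      exact one_div_le_one_div_of_le hr (hrl l hl)
  have hs1 := (L.summable_exp_mul_of_norm_le' hy hb).mul_left (y * z)
  have hs2 := (L.summable_exp_mul_of_norm_le' hy hb2).mul_left (y * z ^ 2)
  have hs3 := (L.summable_exp_mul_of_norm_le' hy hb3).mul_left (y * conj z)
  have hs4 := (L.summable_exp_mul_of_norm_le' hy hb4).mul_left (y * (z * conj z))
  rw [((hs1.add hs2).add hs3).tsum_add hs4, (hs1.add hs2).tsum_add hs3, hs1.tsum_add hs2,
    tsum_mul_left, tsum_mul_left, tsum_mul_left, tsum_mul_left,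
    L.tsum_exp_mul_eq_zero_of_odd y (F := fun w ↦ conj w / w ^ 2) (fun w ↦ by
      rw [map_neg, neg_sq, neg_div]),
    L.tsum_exp_mul_eq_zero_of_odd y (F := fun w ↦ 1 / w) (fun w ↦ by
      rw [one_div, one_div, inv_neg]),
    L.tsum_exp_mul_div_self' hy]
  unfold gaussB
  ring

/-! ### The remainder term -/

/-- **The remainder term**: for `0 < y ≤ 1` and `l ∈ Λ`, with `u = 2y Re(z l̄)` and
`0 < r ≤ |l|` off zero,
`‖e^{-y|l|²} (e^u - 1 - u) (1/l + z/l²)‖ ≤ K₀ · y√y · e^{-(y/4)|l|²}`,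
`K₀ = 8‖z‖²(1 + ‖z‖/r) e^{2‖z‖²}`. [folklore] -/
theorem norm_rem_le' {r : ℝ} (hr : 0 < r) (hrl : ∀ l : L.lattice, (l : ℂ) ≠ 0 → r ≤ ‖(l : ℂ)‖)
    (z : ℂ) {y : ℝ} (hy : 0 < y) (hy1 : y ≤ 1) (l : L.lattice) :
    ‖(rexp (-y * ‖(l : ℂ)‖ ^ 2) : ℂ) *
        ((rexp (2 * y * (z * conj (l : ℂ)).re) - 1 - 2 * y * (z * conj (l : ℂ)).re : ℝ) : ℂ) *
        (1 / (l : ℂ) + z / (l : ℂ) ^ 2)‖ ≤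
      8 * ‖z‖ ^ 2 * (1 + ‖z‖ / r) * rexp (2 * ‖z‖ ^ 2) * (y * Real.sqrt y) *
        rexp (-(y / 4) * ‖(l : ℂ)‖ ^ 2) := by
  have hsy : 0 < Real.sqrt y := Real.sqrt_pos.mpr hy
  rcases eq_or_ne (l : ℂ) 0 with hl | hl
  · rw [hl, div_zero, zero_pow two_ne_zero, div_zero, add_zero, mul_zero, norm_zero]
    positivity
  set n : ℝ := ‖(l : ℂ)‖ with hn
  set u : ℝ := 2 * y * (z * conj (l : ℂ)).re with hu
  have hn1 : r ≤ n := hrl l hl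
  have hn0 : 0 < n := by linarith
  have hρ0 : 0 ≤ rexp u - 1 - u := exp_sub_one_sub_nonneg u
  have hρ : rexp u - 1 - u ≤ u ^ 2 * rexp |u| := exp_sub_one_sub_le u
  have hua : |u| ≤ 2 * y * ‖z‖ * n := abs_two_mul_re_le hy.le z l
  have hu2 : u ^ 2 ≤ (2 * y * ‖z‖ * n) ^ 2 := by
    rw [← sq_abs u]
    exact pow_le_pow_left₀ (abs_nonneg u) hua 2
  have hkey : 2 * y * ‖z‖ * n ≤ y / 2 * n ^ 2 + 2 * ‖z‖ ^ 2 := by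
    nlinarith [sq_nonneg (n - 2 * ‖z‖), norm_nonneg z, sq_nonneg ‖z‖, hy.le]
  have hexp : rexp |u| ≤ rexp (y / 2 * n ^ 2) * rexp (2 * ‖z‖ ^ 2) := by
    rw [← Real.exp_add]
    exact Real.exp_le_exp.mpr (hua.trans hkey)
  have hh : ‖1 / (l : ℂ) + z / (l : ℂ) ^ 2‖ ≤ (1 + ‖z‖ / r) / n := L.norm_h_le_div' hr hrl z hl
  have hnexp : n * rexp (-(y / 4) * n ^ 2) ≤ 2 / Real.sqrt y :=
    mul_exp_neg_le_two_div_sqrt hy hn0.le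
  have hcomb : rexp (-y * n ^ 2) * rexp (y / 2 * n ^ 2) =
      rexp (-(y / 4) * n ^ 2) * rexp (-(y / 4) * n ^ 2) := by
    rw [← Real.exp_add, ← Real.exp_add]; congr 1; ring
  have hzr : 0 ≤ 1 + ‖z‖ / r := by positivity
  rw [norm_mul, norm_mul, Complex.norm_real, Complex.norm_real, Real.norm_eq_abs,
    Real.norm_eq_abs, abs_of_pos (Real.exp_pos _), abs_of_nonneg hρ0]
  calc rexp (-y * n ^ 2) * (rexp u - 1 - u) * ‖1 / (l : ℂ) + z / (l : ℂ) ^ 2‖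
      ≤ rexp (-y * n ^ 2) * ((2 * y * ‖z‖ * n) ^ 2 * (rexp (y / 2 * n ^ 2) * rexp (2 * ‖z‖ ^ 2)))
          * ((1 + ‖z‖ / r) / n) := by
        gcongr
        exact hρ.trans (mul_le_mul hu2 hexp (Real.exp_pos _).le (sq_nonneg _))
    _ = 4 * ‖z‖ ^ 2 * (1 + ‖z‖ / r) * rexp (2 * ‖z‖ ^ 2) * y ^ 2 *
          (rexp (-y * n ^ 2) * rexp (y / 2 * n ^ 2)) * n := by
        field_simp
        ring
    _ = 4 * ‖z‖ ^ 2 * (1 + ‖z‖ / r) * rexp (2 * ‖z‖ ^ 2) * y ^ 2 * rexp (-(y / 4) * n ^ 2) *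
          (n * rexp (-(y / 4) * n ^ 2)) := by
        rw [hcomb]; ring
    _ ≤ 4 * ‖z‖ ^ 2 * (1 + ‖z‖ / r) * rexp (2 * ‖z‖ ^ 2) * y ^ 2 * rexp (-(y / 4) * n ^ 2) *
          (2 / Real.sqrt y) := by
        gcongr
    _ = 8 * ‖z‖ ^ 2 * (1 + ‖z‖ / r) * rexp (2 * ‖z‖ ^ 2) * (y * Real.sqrt y) *
          rexp (-(y / 4) * n ^ 2) := by
        field_simp
        rw [Real.sq_sqrt hy.le]
        ring

/-- The remainder sum is bounded by `K₀ y√y N(y/4)` for `0 < y ≤ 1`. [folklore] -/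
theorem norm_gaussRem_le {r : ℝ} (hr : 0 < r) (hrl : ∀ l : L.lattice, (l : ℂ) ≠ 0 → r ≤ ‖(l : ℂ)‖)
    (z : ℂ) {y : ℝ} (hy : 0 < y) (hy1 : y ≤ 1) :
    ‖L.gaussRem y z‖ ≤
      8 * ‖z‖ ^ 2 * (1 + ‖z‖ / r) * rexp (2 * ‖z‖ ^ 2) * (y * Real.sqrt y) * L.gaussN (y / 4) := by
  have h4 : 0 < y / 4 := by positivity
  unfold gaussRem gaussN
  exact tsum_of_norm_bounded ((L.summable_exp_neg_mul_norm_sq h4).hasSum.mul_left _)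
    (L.norm_rem_le' hr hrl z hy hy1)

/-- The remainder family is summable (`0 < y ≤ 1`). [folklore] -/
theorem summable_rem' (z : ℂ) {y : ℝ} (hy : 0 < y) (hy1 : y ≤ 1) :
    Summable fun l : L.lattice ↦ (rexp (-y * ‖(l : ℂ)‖ ^ 2) : ℂ) *
        ((rexp (2 * y * (z * conj (l : ℂ)).re) - 1 - 2 * y * (z * conj (l : ℂ)).re : ℝ) : ℂ) *
        (1 / (l : ℂ) + z / (l : ℂ) ^ 2) := by
  obtain ⟨r, hr, -, hrl⟩ := L.exists_pos_forall_le_norm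
  have h4 : 0 < y / 4 := by positivity
  exact Summable.of_norm_bounded ((L.summable_exp_neg_mul_norm_sq h4).mul_left _)
    (L.norm_rem_le' hr hrl z hy hy1)

/-- **The remainder sum tends to `0`** as `y → 0⁺`, granted a bound `y N(y) ≤ C` near `0⁺`.
[folklore] -/
theorem tendsto_gaussRem (hB : ∃ C : ℝ, ∀ᶠ y : ℝ in 𝓝[>] 0, y * L.gaussN y ≤ C) (z : ℂ) :
    Tendsto (fun y : ℝ ↦ L.gaussRem y z) (𝓝[>] 0) (𝓝 0) := by
  obtain ⟨r, hr, -, hrl⟩ := L.exists_pos_forall_le_norm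
  obtain ⟨C, hC⟩ := hB
  set K : ℝ := 8 * ‖z‖ ^ 2 * (1 + ‖z‖ / r) * rexp (2 * ‖z‖ ^ 2) with hK
  have hK0 : 0 ≤ K := by positivity
  -- the bound `(y/4) N(y/4) ≤ C` eventually
  have hq : ∀ᶠ y : ℝ in 𝓝[>] 0, (y / 4) * L.gaussN (y / 4) ≤ C :=
    (tendsto_div_const_nhdsGT_zero four_pos).eventually hC
  have hsqrt : Tendsto (fun y : ℝ ↦ Real.sqrt y) (𝓝[>] 0) (𝓝 0) := by
    have h := Real.continuous_sqrt.tendsto 0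
    rw [Real.sqrt_zero] at h
    exact h.mono_left nhdsWithin_le_nhds
  have hbound : Tendsto (fun y : ℝ ↦ K * Real.sqrt y * (4 * C)) (𝓝[>] 0) (𝓝 (K * 0 * (4 * C))) :=
    (hsqrt.const_mul K).mul_const _
  rw [mul_zero, zero_mul] at hbound
  refine squeeze_zero_norm' ?_ hbound
  filter_upwards [Ioc_mem_nhdsGT (zero_lt_one' ℝ), hq] with y hy hqy
  refine (L.norm_gaussRem_le hr hrl z hy.1 hy.2).trans ?_
  have hsy : 0 ≤ Real.sqrt y := Real.sqrt_nonneg y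
  calc K * (y * Real.sqrt y) * L.gaussN (y / 4) = K * Real.sqrt y * (4 * ((y / 4) * L.gaussN (y / 4))) := by
        ring
    _ ≤ K * Real.sqrt y * (4 * C) := by gcongr

/-! ### The decomposition of `K_y(z)` -/

/-- **`∑_l e^{-y|z-l|²} (1/l + z/l²) = e^{-y|z|²} (α(y) z + β(y) z̄ + Rem_y(z))`** for
`0 < y ≤ 1`: the first-order part of the Gauss-damped sum is `ℝ`-linear in `z`. [folklore] -/
theorem tsum_exp_mul_h_eq (z : ℂ) {y : ℝ} (hy : 0 < y) (hy1 : y ≤ 1) :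
    ∑' l : L.lattice, (rexp (-y * ‖z - (l : ℂ)‖ ^ 2) : ℂ) * (1 / (l : ℂ) + z / (l : ℂ) ^ 2) =
      ((rexp (-y * ‖z‖ ^ 2) : ℝ) : ℂ) *
        (L.kroneckerCoefα y * z + L.kroneckerCoefβ y * conj z + L.gaussRem y z) := by
  obtain ⟨r, hr, -, hrl⟩ := L.exists_pos_forall_le_norm
  have hsA : Summable fun l : L.lattice ↦
      (rexp (-y * ‖(l : ℂ)‖ ^ 2) : ℂ) * (1 / (l : ℂ) + z / (l : ℂ) ^ 2) :=
    L.summable_exp_mul_of_norm_le' hy (L.norm_h_le' hr hrl z)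
  have hsB : Summable fun l : L.lattice ↦
      (rexp (-y * ‖(l : ℂ)‖ ^ 2) : ℂ) * (((2 * y * (z * conj (l : ℂ)).re : ℝ) : ℂ) *
        (1 / (l : ℂ) + z / (l : ℂ) ^ 2)) := by
    refine L.summable_exp_mul_of_norm_le' hy (C := 2 * y * ‖z‖ * (1 + ‖z‖ / r)) fun l ↦ ?_
    rcases eq_or_ne (l : ℂ) 0 with hl | hl
    · rw [hl, div_zero, zero_pow two_ne_zero, div_zero, add_zero, mul_zero, norm_zero]
      positivity
    · have hn0 : 0 < ‖(l : ℂ)‖ := by linarith [hrl l hl]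
      rw [norm_mul, Complex.norm_real, Real.norm_eq_abs]
      calc |2 * y * (z * conj (l : ℂ)).re| * ‖1 / (l : ℂ) + z / (l : ℂ) ^ 2‖
          ≤ (2 * y * ‖z‖ * ‖(l : ℂ)‖) * ((1 + ‖z‖ / r) / ‖(l : ℂ)‖) :=
            mul_le_mul (abs_two_mul_re_le hy.le z l) (L.norm_h_le_div' hr hrl z hl)
              (norm_nonneg _) (by positivity)
        _ = 2 * y * ‖z‖ * (1 + ‖z‖ / r) := by field_simp
  have hsC := L.summable_rem' z hy hy1
  have key : ∀ l : L.lattice,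
      (rexp (-y * ‖z - (l : ℂ)‖ ^ 2) : ℂ) * (1 / (l : ℂ) + z / (l : ℂ) ^ 2) =
      ((rexp (-y * ‖z‖ ^ 2) : ℝ) : ℂ) *
        ((rexp (-y * ‖(l : ℂ)‖ ^ 2) : ℂ) * (1 / (l : ℂ) + z / (l : ℂ) ^ 2) +
         (rexp (-y * ‖(l : ℂ)‖ ^ 2) : ℂ) * (((2 * y * (z * conj (l : ℂ)).re : ℝ) : ℂ) *
           (1 / (l : ℂ) + z / (l : ℂ) ^ 2)) +
         (rexp (-y * ‖(l : ℂ)‖ ^ 2) : ℂ) *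
           ((rexp (2 * y * (z * conj (l : ℂ)).re) - 1 - 2 * y * (z * conj (l : ℂ)).re : ℝ) : ℂ) *
           (1 / (l : ℂ) + z / (l : ℂ) ^ 2)) := by
    intro l
    rw [exp_neg_mul_norm_sub_sq_eq y z l]
    push_cast
    ring
  simp_rw [key]
  rw [tsum_mul_left, (hsA.add hsB).tsum_add hsC, hsA.tsum_add hsB, L.tsum_exp_mul_h' z hy]
  congr 1
  have hB := L.tsum_exp_mul_u_mul_h' z hy
  simp only [mul_assoc] at hB ⊢
  rw [hB]
  unfold kroneckerCoefα kroneckerCoefβ gaussRem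
  simp only [mul_assoc]
  ring

/-- **The decomposition of the Gauss-damped sum** (`0 < y ≤ 1`):
`K_y(z) = ∑_l e^{-y|z-l|²} g(l) - e^{-y|z|²} (α(y) z + β(y) z̄ + Rem_y(z))`,
`g(l) = 1/(z-l) + 1/l + z/l²`. [folklore] -/
theorem kroneckerSum_eq (z : ℂ) {y : ℝ} (hy : 0 < y) (hy1 : y ≤ 1) :
    L.kroneckerSum y z =
      (∑' l : L.lattice,
        (rexp (-y * ‖z - (l : ℂ)‖ ^ 2) : ℂ) * (1 / (z - l) + 1 / (l : ℂ) + z / (l : ℂ) ^ 2)) -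
      ((rexp (-y * ‖z‖ ^ 2) : ℝ) : ℂ) *
        (L.kroneckerCoefα y * z + L.kroneckerCoefβ y * conj z + L.gaussRem y z) := by
  obtain ⟨r, hr, -, hrl⟩ := L.exists_pos_forall_le_norm
  rw [← L.tsum_exp_mul_h_eq z hy hy1]
  have hsg : Summable fun l : L.lattice ↦
      (rexp (-y * ‖z - (l : ℂ)‖ ^ 2) : ℂ) * (1 / (z - l) + 1 / (l : ℂ) + z / (l : ℂ) ^ 2) := by
    refine Summable.of_norm_bounded (L.summable_norm_zetaSummand' z) fun l ↦ ?_
    rw [norm_mul, Complex.norm_real, Real.norm_eq_abs, abs_of_pos (Real.exp_pos _)]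
    refine mul_le_of_le_one_left (norm_nonneg _) ?_
    rw [Real.exp_le_one_iff]
    nlinarith [sq_nonneg ‖z - (l : ℂ)‖]
  have hsh : Summable fun l : L.lattice ↦
      (rexp (-y * ‖z - (l : ℂ)‖ ^ 2) : ℂ) * (1 / (l : ℂ) + z / (l : ℂ) ^ 2) := by
    refine Summable.of_norm_bounded
      (((L.summable_exp_neg_mul_norm_sq (by positivity : 0 < y / 2)).mul_left
        (rexp (y * ‖z‖ ^ 2))).mul_right (1 / r + ‖z‖ / r ^ 2)) fun l ↦ ?_
    rw [norm_mul, Complex.norm_real, Real.norm_eq_abs, abs_of_pos (Real.exp_pos _)]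
    exact mul_le_mul (exp_neg_mul_norm_sub_sq_le hy.le z l) (L.norm_h_le' hr hrl z l)
      (norm_nonneg _) (by positivity)
  unfold kroneckerSum
  rw [← hsg.tsum_sub hsh]
  refine tsum_congr fun l ↦ ?_
  ring

/-! ### From convergent points to convergent coefficients -/

/-- **A convergent point controls the first-order part**: if `K_y(z) → c` then
`α(y) z + β(y) z̄ → ζ(z) - c` (granted the bound on `y N(y)`, which kills the remainder).
[folklore] -/
theorem tendsto_coef_comb_of_tendsto_kroneckerSum
    (hB : ∃ C : ℝ, ∀ᶠ y : ℝ in 𝓝[>] 0, y * L.gaussN y ≤ C) {z c : ℂ}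
    (h : Tendsto (fun y : ℝ ↦ L.kroneckerSum y z) (𝓝[>] 0) (𝓝 c)) :
    Tendsto (fun y : ℝ ↦ L.kroneckerCoefα y * z + L.kroneckerCoefβ y * conj z) (𝓝[>] 0)
      (𝓝 (L.weierstrassZeta z - c)) := by
  have hG := L.tendsto_tsum_exp_mul_zetaSummand' z
  have hR := L.tendsto_gaussRem hB z
  have hE : Tendsto (fun y : ℝ ↦ ((rexp (y * ‖z‖ ^ 2) : ℝ) : ℂ)) (𝓝[>] 0) (𝓝 1) := by
    have h1 := tendsto_ofReal_exp_neg_mul (-‖z‖ ^ 2)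
    refine h1.congr fun y ↦ ?_
    congr 1
    ring_nf
  -- `α z + β z̄ = e^{y|z|²} (G_y - K_y) - Rem_y`
  have hlim : Tendsto (fun y : ℝ ↦ ((rexp (y * ‖z‖ ^ 2) : ℝ) : ℂ) *
      ((∑' l : L.lattice, (rexp (-y * ‖z - (l : ℂ)‖ ^ 2) : ℂ) *
        (1 / (z - l) + 1 / (l : ℂ) + z / (l : ℂ) ^ 2)) - L.kroneckerSum y z) - L.gaussRem y z)
      (𝓝[>] 0) (𝓝 (1 * (L.weierstrassZeta z - c) - 0)) :=
    (hE.mul (hG.sub h)).sub hR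
  rw [one_mul, sub_zero] at hlim
  refine hlim.congr' ?_
  filter_upwards [Ioc_mem_nhdsGT (zero_lt_one' ℝ)] with y hy
  rw [L.kroneckerSum_eq z hy.1 hy.2]
  have hee : ((rexp (y * ‖z‖ ^ 2) : ℝ) : ℂ) * ((rexp (-y * ‖z‖ ^ 2) : ℝ) : ℂ) = 1 := by
    rw [← Complex.ofReal_mul, ← Real.exp_add]
    simp
  linear_combination (L.kroneckerCoefα y * z + L.kroneckerCoefβ y * conj z + L.gaussRem y z) * hee

/-- **Two `ℝ`-independent convergent points give convergent coefficients.** If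
`α(y) zⱼ + β(y) z̄ⱼ → pⱼ` (`j = 1, 2`) with `z₁ z̄₂ - z₂ z̄₁ ≠ 0` (i.e. `z₁, z₂` are `ℝ`-linearly
independent), then `α(y)` and `β(y)` converge (Cramer's rule). [folklore] -/
theorem tendsto_coef_of_tendsto_comb₂ {z₁ z₂ p₁ p₂ : ℂ} (hD : z₁ * conj z₂ - z₂ * conj z₁ ≠ 0)
    (h₁ : Tendsto (fun y : ℝ ↦ L.kroneckerCoefα y * z₁ + L.kroneckerCoefβ y * conj z₁) (𝓝[>] 0)
      (𝓝 p₁))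
    (h₂ : Tendsto (fun y : ℝ ↦ L.kroneckerCoefα y * z₂ + L.kroneckerCoefβ y * conj z₂) (𝓝[>] 0)
      (𝓝 p₂)) :
    Tendsto L.kroneckerCoefα (𝓝[>] 0) (𝓝 ((p₁ * conj z₂ - p₂ * conj z₁) / (z₁ * conj z₂ - z₂ * conj z₁))) ∧
    Tendsto L.kroneckerCoefβ (𝓝[>] 0) (𝓝 ((p₂ * z₁ - p₁ * z₂) / (z₁ * conj z₂ - z₂ * conj z₁))) := by
  set D : ℂ := z₁ * conj z₂ - z₂ * conj z₁ with hDdef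
  constructor
  · have h := ((h₁.mul_const (conj z₂)).sub (h₂.mul_const (conj z₁))).div_const D
    refine h.congr fun y ↦ ?_
    field_simp
    ring
  · have h := ((h₂.mul_const z₁).sub (h₁.mul_const z₂)).div_const D
    refine h.congr fun y ↦ ?_
    field_simp
    ring

/-- **Convergent coefficients give the limit at every point**: if `α(y) → α₀`, `β(y) → β₀`
(and `y N(y)` is bounded), then `K_y(z) → ζ(z) - (α₀ z + β₀ z̄)` for every `z`. [folklore] -/
theorem tendsto_kroneckerSum_of_tendsto_coef
    (hB : ∃ C : ℝ, ∀ᶠ y : ℝ in 𝓝[>] 0, y * L.gaussN y ≤ C) {α₀ β₀ : ℂ}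
    (hα : Tendsto L.kroneckerCoefα (𝓝[>] 0) (𝓝 α₀))
    (hβ : Tendsto L.kroneckerCoefβ (𝓝[>] 0) (𝓝 β₀)) (z : ℂ) :
    Tendsto (fun y : ℝ ↦ L.kroneckerSum y z) (𝓝[>] 0)
      (𝓝 (L.weierstrassZeta z - (α₀ * z + β₀ * conj z))) := by
  have hG := L.tendsto_tsum_exp_mul_zetaSummand' z
  have hR := L.tendsto_gaussRem hB z
  have hE := tendsto_ofReal_exp_neg_mul (‖z‖ ^ 2)
  have hlim : Tendsto (fun y : ℝ ↦
      (∑' l : L.lattice, (rexp (-y * ‖z - (l : ℂ)‖ ^ 2) : ℂ) *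
        (1 / (z - l) + 1 / (l : ℂ) + z / (l : ℂ) ^ 2)) -
      ((rexp (-y * ‖z‖ ^ 2) : ℝ) : ℂ) *
        (L.kroneckerCoefα y * z + L.kroneckerCoefβ y * conj z + L.gaussRem y z))
      (𝓝[>] 0) (𝓝 (L.weierstrassZeta z - 1 * (α₀ * z + β₀ * conj z + 0))) :=
    hG.sub (hE.mul (((hα.mul_const z).add (hβ.mul_const (conj z))).add hR))
  rw [one_mul, add_zero] at hlim
  refine hlim.congr' ?_
  filter_upwards [Ioc_mem_nhdsGT (zero_lt_one' ℝ)] with y hy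
  exact (L.kroneckerSum_eq z hy.1 hy.2).symm

/-! ### Periodicity pins the coefficients to the quasi-periods -/

/-- **`K_y` is `Λ`-periodic**: `K_y(z + ω) = K_y(z)` for `ω ∈ Λ` (reindex `l ↦ l - ω`).
[folklore] -/
theorem kroneckerSum_add_coe (y : ℝ) (z : ℂ) (ω : L.lattice) :
    L.kroneckerSum y (z + ω) = L.kroneckerSum y z := by
  unfold kroneckerSum
  rw [← (Equiv.addRight ω).tsum_eq]
  refine tsum_congr fun l ↦ ?_
  simp only [Equiv.coe_addRight, Submodule.coe_add]
  rw [show z + (ω : ℂ) - ((l : ℂ) + ω) = z - l by ring]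

/-- **The limiting coefficients are the quasi-periods**: if `K_y(z) → ζ(z) - (α₀ z + β₀ z̄)` for
all `z`, then `α₀ ωᵢ + β₀ ω̄ᵢ = ηᵢ` (`i = 1, 2`): compare the limits at `ω₁/2` and `ω₁/2 + ωᵢ`,
using `K_y(z + ωᵢ) = K_y(z)` and `ζ(z + ωᵢ) = ζ(z) + ηᵢ`. [folklore] -/
theorem coef_eq_quasiPeriod_of_tendsto {α₀ β₀ : ℂ}
    (h : ∀ z : ℂ, Tendsto (fun y : ℝ ↦ L.kroneckerSum y z) (𝓝[>] 0)
      (𝓝 (L.weierstrassZeta z - (α₀ * z + β₀ * conj z)))) :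
    α₀ * L.ω₁ + β₀ * conj L.ω₁ = L.η₁ ∧ α₀ * L.ω₂ + β₀ * conj L.ω₂ = L.η₂ := by
  set z₀ : ℂ := L.ω₁ / 2 with hz₀
  have key : ∀ ω : L.lattice, L.weierstrassZeta (z₀ + ω) - (α₀ * (z₀ + ω) + β₀ * conj (z₀ + ω)) =
      L.weierstrassZeta z₀ - (α₀ * z₀ + β₀ * conj z₀) := by
    intro ω
    have h1 := h (z₀ + ω)
    have h2 : Tendsto (fun y : ℝ ↦ L.kroneckerSum y (z₀ + ω)) (𝓝[>] 0)
        (𝓝 (L.weierstrassZeta z₀ - (α₀ * z₀ + β₀ * conj z₀))) :=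
      (h z₀).congr fun y ↦ (L.kroneckerSum_add_coe y z₀ ω).symm
    exact tendsto_nhds_unique h1 h2
  constructor
  · have k := key ⟨L.ω₁, L.ω₁_mem_lattice⟩
    rw [L.weierstrassZeta_add_ω₁_eq z₀, map_add] at k
    linear_combination -k
  · have k := key ⟨L.ω₂, L.ω₂_mem_lattice⟩
    rw [L.weierstrassZeta_add_ω₂_eq z₀, map_add] at k
    linear_combination -k

/-- The `ℝ`-linear map `z ↦ α₀ z + β₀ z̄`. [folklore] -/
def coefLinearMap (α₀ β₀ : ℂ) : ℂ →ₗ[ℝ] ℂ :=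
  α₀ • (LinearMap.id : ℂ →ₗ[ℝ] ℂ) + β₀ • Complex.conjAe.toLinearMap

omit L in
/-- `coefLinearMap α₀ β₀ z = α₀ z + β₀ z̄`. [folklore] -/
@[simp] theorem coefLinearMap_apply (α₀ β₀ z : ℂ) :
    coefLinearMap α₀ β₀ z = α₀ * z + β₀ * conj z := by
  simp [coefLinearMap]

/-- **An `ℝ`-linear map matching the quasi-periods on `(ω₁, ω₂)` is the quasi-period map**:
if `α₀ ωᵢ + β₀ ω̄ᵢ = ηᵢ` for `i = 1, 2` then `α₀ z + β₀ z̄ = η(z)` (`L.quasiPeriodMap z`) for all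
`z` (two `ℝ`-linear maps agreeing on Mathlib's real basis `L.basis = (ω₁, ω₂)` of `ℂ`).
[cite: Silverman1994, Prop VI.3.1] -/
theorem coef_comb_eq_quasiPeriodMap {α₀ β₀ : ℂ} (h₁ : α₀ * L.ω₁ + β₀ * conj L.ω₁ = L.η₁)
    (h₂ : α₀ * L.ω₂ + β₀ * conj L.ω₂ = L.η₂) (z : ℂ) :
    α₀ * z + β₀ * conj z = L.quasiPeriodMap z := by
  have hmaps : coefLinearMap α₀ β₀ = L.quasiPeriodMap := by
    refine L.basis.ext fun i ↦ ?_
    fin_cases i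
    · simp [h₁]
    · simp [h₂]
  rw [← coefLinearMap_apply, hmaps]

/-! ### The main theorem -/

/-- **Kronecker's limit formula of weight one on an arbitrary lattice, from two convergent
points** (Rubin, LNM 1716, Prop. 7.12 for `k = 1`: `E₁(z; L) = (log σ)'(z) - s₂(L) z - A(L)⁻¹ z̄`,
with `E₁` summed at `s = 1`; here in the Gauss-damped form). Let `Λ = ℤω₁ + ℤω₂`. Suppose that
`y ∑_{l ∈ Λ} e^{-y|l|²}` stays bounded as `y → 0⁺` (`hB`) and that the damped sums
`K_y(zⱼ) = ∑_l e^{-y|zⱼ-l|²}/(zⱼ - l)` converge as `y → 0⁺` for two points `z₁, z₂` with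
`z₁ z̄₂ - z₂ z̄₁ ≠ 0` (`ℝ`-linearly independent). Then for **every** `z ∈ ℂ`,

  `lim_{y → 0⁺} ∑_{l ∈ Λ} e^{-y|z-l|²}/(z - l) = ζ(z; Λ) - η(z; Λ)`,

`ζ` the Weierstrass zeta function and `η = L.quasiPeriodMap` the `ℝ`-linear extension of the
quasi-period map (`= s₂(L) z + A(L)⁻¹ z̄` in Rubin's notation, Def. 7.9). For `Λ = ℤi + ℤ` this is
`GaussianLattice.tendsto_tsum_exp_div_sub` (`η(z) = π z̄`).
[cite: Rubin1999, §7.4 Def. 7.9, Def. 7.11, Prop. 7.12 (LNM 1716 p. 244)] -/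
theorem tendsto_kroneckerSum_of_tendsto₂
    (hB : ∃ C : ℝ, ∀ᶠ y : ℝ in 𝓝[>] 0, y * L.gaussN y ≤ C) {z₁ z₂ c₁ c₂ : ℂ}
    (hD : z₁ * conj z₂ - z₂ * conj z₁ ≠ 0)
    (h₁ : Tendsto (fun y : ℝ ↦ L.kroneckerSum y z₁) (𝓝[>] 0) (𝓝 c₁))
    (h₂ : Tendsto (fun y : ℝ ↦ L.kroneckerSum y z₂) (𝓝[>] 0) (𝓝 c₂)) (z : ℂ) :
    Tendsto (fun y : ℝ ↦ L.kroneckerSum y z) (𝓝[>] 0)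
      (𝓝 (L.weierstrassZeta z - L.quasiPeriodMap z)) := by
  obtain ⟨hα, hβ⟩ := L.tendsto_coef_of_tendsto_comb₂ hD
    (L.tendsto_coef_comb_of_tendsto_kroneckerSum hB h₁)
    (L.tendsto_coef_comb_of_tendsto_kroneckerSum hB h₂)
  have hall := L.tendsto_kroneckerSum_of_tendsto_coef hB hα hβ
  obtain ⟨e₁, e₂⟩ := L.coef_eq_quasiPeriod_of_tendsto hall
  rw [← L.coef_comb_eq_quasiPeriodMap e₁ e₂ z]
  exact hall z

/-- **Corollary: the limiting coefficients.** Under the same hypotheses,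
`y (∑_l e^{-y|l|²} - 1) → β₀` and `∑' e^{-y|l|²}/l² + y ∑' e^{-y|l|²} l̄/l → α₀` where
`α₀ z + β₀ z̄ = η(z)` is the quasi-period map; in Rubin's notation `α₀ = s₂(L)`, `β₀ = A(L)⁻¹`
(so the Gaussian sum `y ∑ e^{-y|l|²}` tends to `π/area(ℂ/Λ)`, by the Legendre relation).
[cite: Rubin1999, §7.4 Def. 7.9] -/
theorem tendsto_kroneckerCoef_of_tendsto₂
    (hB : ∃ C : ℝ, ∀ᶠ y : ℝ in 𝓝[>] 0, y * L.gaussN y ≤ C) {z₁ z₂ c₁ c₂ : ℂ}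
    (hD : z₁ * conj z₂ - z₂ * conj z₁ ≠ 0)
    (h₁ : Tendsto (fun y : ℝ ↦ L.kroneckerSum y z₁) (𝓝[>] 0) (𝓝 c₁))
    (h₂ : Tendsto (fun y : ℝ ↦ L.kroneckerSum y z₂) (𝓝[>] 0) (𝓝 c₂)) :
    ∃ α₀ β₀ : ℂ, Tendsto L.kroneckerCoefα (𝓝[>] 0) (𝓝 α₀) ∧
      Tendsto L.kroneckerCoefβ (𝓝[>] 0) (𝓝 β₀) ∧
      ∀ z : ℂ, α₀ * z + β₀ * conj z = L.quasiPeriodMap z := by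
  obtain ⟨hα, hβ⟩ := L.tendsto_coef_of_tendsto_comb₂ hD
    (L.tendsto_coef_comb_of_tendsto_kroneckerSum hB h₁)
    (L.tendsto_coef_comb_of_tendsto_kroneckerSum hB h₂)
  have hall := L.tendsto_kroneckerSum_of_tendsto_coef hB hα hβ
  obtain ⟨e₁, e₂⟩ := L.coef_eq_quasiPeriod_of_tendsto hall
  exact ⟨_, _, hα, hβ, L.coef_comb_eq_quasiPeriodMap e₁ e₂⟩

end PeriodPair

end
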